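import Summits.ResolutionOfSingularities.ResolutionOfSingularities.Theorems.WildConesCampaignW46ForcedAtomsMeasureRat
import Summits.ResolutionOfSingularities.ResolutionOfSingularities.Theorems.WildConesCampaignW46ForcedAtomsFiniteSing
import Summits.ResolutionOfSingularities.ResolutionOfSingularities.Theorems.WildConesCampaignW46ForcedAtomRational
import Summits.ResolutionOfSingularities.ResolutionOfSingularities.Theorems.WildConesCampaignW46ResidueField
import HarnessLib

/-!
# [OURS · L1 W4.6, rung (i) SURFACES IN 3-SPACE and CURVES IN THE PLANE, GEOMETRIC FORM — brick 39 = brick 33 over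
# FINITE fields and over PERFECT fields at `K`-RATIONAL singular points] The finite local exit bound in the forced-atom
# regime WITH FINITELY MANY SINGULAR POINTS, `n ≤ 2`, every characteristic, `K` finite resp. `K` perfect with the
# singular points `K`-rational at every stage

Cell res-hironaka (LADDER-RESOLUTION rung L, D-0089), slot W4.6 «restricted regimes as rungs», seat res-L1-s46-pv-2
(gen 5). Host: route `WildCones`, crux `ClassicalRegimes` (stmt-ResolutionOfSingularities-16884),
`--supports … --as helper`.

RATIONAL / FINITE FORM (gen 5, after brick 33 p554193): brick 33 used `K` algebraically closed only to make the singular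
points of the transform rational relative to the blow-up; here that rationality is either AUTOMATIC (`K` finite: both
residue fields are `K`, bricks 16/17 `exists_sub_map_mem_maximalIdeal_of_finite`) or part of the regime (`K` perfect and
every singular point `K`-rational, p528983 `exists_sub_stalkMap_mem_maximalIdeal_of_kRational`) — as for the old rung
(p528213 / p528983 / p537008). Names carry the suffix `_rat` / `_of_finite` / `Rational`.

HONEST FRAMING. Everything here is OURS. NOTHING below is a statement of H. Hironaka's manuscript [Hironaka2017] and
nothing asserts that any statement of it holds: res-L1-s46-pv-1's résumé-free vocabulary and res-L1-type-o1's typed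
procedure (`FinLocalExitBound`, `PermissiblyTerminates`, `Terminates`, `Regime.isolatedSing`), res-L1-s46-pv-9's run
layer (`finLocalExitBound_of_stepMeasureDrop`, `stepMeasureDrop_of_offCentre_of_centre`, `transform_germ_eq_off_centre`)
and the typed candidate carriers of row 001 enter as DEFINITIONS; the mathematics is this seat's dictionary (bricks
1–32) over route `WildCones`' own calculus. No FACT-LIST premise is used. AI review is weaker than expert review.

## THE REGIME (stated as a hypothesis `hRg` on an arbitrary regime `Rg`, def-free): «FORCED ATOMS WITH FINITELY MANY
## SINGULAR POINTS in `n + 1` variables» — at the state `(A, E)`: `E.b = p`; `Sing(E)` is a FINITE set of CLOSED points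
## (`Regime.isolatedSing`); and at every `ξ ∈ Sing(E)`: embedding dimension `n + 1`, SOME presentation
## `𝒪̂_{Z,ξ} ≅ K⟦z,u⟧` of `J_ξ` by a unit times a height-one atom `z^p − ser c₀`, and EVERY presentation isolated
## (`Isol c₀`). This is res-L1-type-o1's `Regime.forcedAtom n` (p517839) with the clause «`Sing(E)` has AT MOST ONE point»
## replaced by «`Sing(E)` finite»: a surface in a smooth threefold may now have any finite number of isolated forced
## `p`-fold points, and a blow-up may create several.

## What is proved (`K` perfect of characteristic `p`)

* `finLocalExitBound_of_calculus_rat` — general `n ≥ 1` under the three calculus hypotheses of brick 33 and a RELATIVE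
  RATIONALITY hypothesis on the in-regime steps («every singular point of the transform is rational relative to the
  blow-up»): `FinLocalExitBound Rg` with `β = 4^μ`. Proof verbatim brick 33's over bricks 36–38.
* **`finLocalExitBound_of_le_forcedAtomsSurface_of_finite`** / `…Curve_of_finite` — `K` FINITE, `n = 2` / `n = 1`, every
  `p`: every regime contained in the finite-`Sing` forced-atom class has `FinLocalExitBound` (rationality automatic).
* **`finLocalExitBound_of_le_forcedAtomsSurfaceRational`** / `…CurveRational` — `K` PERFECT, the class with every
  singular point `K`-rational (at every stage), `n = 2` / `n = 1`, every `p`.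
* `permissiblyTerminates_…` corollaries of both.

NOT claimed: `n ≥ 3`; perfect `K` with non-rational singular points (residue (R1)).
References: this seat's bricks and HOME/L/res-L1-s46-pv-2/RUNG-I-FORCED-ATOM-SUMMARY.md; H. Hironaka, ms. 2017,
Th. 16.6 p.84, Th. 16.13 p.87 l.26–28 — ROLE of «the procedure ends after finitely many steps» restricted to this
regime only, under adjudication, not cited as fact. [folklore]
-/

noncomputable section

-- single-problem summit: the doubled namespace component `ResolutionOfSingularities` is forced
set_option linter.dupNamespace false

open scoped BigOperators Classical
open MvPowerSeries IsLocalRing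

namespace Summit.ResolutionOfSingularities.ResolutionOfSingularities.Theorems

namespace CampaignW46.ForcedAtom

open CategoryTheory AlgebraicGeometry TopologicalSpace
open Literature.AlgebraicGeometry.Resolution
open Literature.AlgebraicGeometry.Hironaka2017.S02Preliminaries
open Literature.AlgebraicGeometry.Hironaka2017.Datum
open Scheme.IdealSheafData
open WildCones
open CampaignW46.ChartPoint CampaignW46.AtomGerm CampaignW46.FormalChart

variable {p : ℕ} [Fact p.Prime] {K : Type} [Field K] [CharP K p] [PerfectField K] {n : ℕ}

/-! ## General `n`: the finite local exit bound from the three calculus hypotheses -/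

/-- [OURS · L1 W4.6 rung (i) with finitely many singular points, general `n ≥ 1` — replaces the role of the termination
clause of Th. 16.13 p.87 l.26–28 / the uniform bound shape of Eq. (127) p.84 (H. Hironaka, ms. 2017) RESTRICTED to the
forced-atom regime with finite singular locus; NOT a statement of the manuscript] Under the calculus hypotheses (ord),
(cnt), (μ) in `n` variables, every regime contained in «forced atoms with finitely many singular points in `n + 1`
variables» whose in-regime steps have relatively rational singular points has `FinLocalExitBound` (with `β = 4^μ`);
RATIONAL FORM of brick 33. [folklore] -/
theorem finLocalExitBound_of_calculus_rat (hn : 0 < n)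
    (hord : ∀ (a : (Fin n → ℕ) → K) (i : Fin n) (τ : Fin n → K), MultP p n K a →
      Isol p n K (step p n K i τ a) → MultP p n K (step p n K i τ a) →
        ser p n K a ∈ maximalIdeal (MvPowerSeries (Fin n) K) ^ (p + 1))
    (hcnt : ∀ (a : (Fin n → ℕ) → K), MultP p n K a → ∀ T : Finset (Fin n × (Fin n → K)),
      (∀ d ∈ T, Isol p n K (step p n K d.1 d.2 a) ∧ MultP p n K (step p n K d.1 d.2 a) ∧
        ∀ l : Fin n, l ≤ d.1 → d.2 l = 0) → T.card ≤ 3)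
    (hmu : MuDrop p n K) (Rg : Regime p K)
    (hRg : ∀ (A : AmbientDatum p K) (E : IdealExponent A.Z), Rg A E →
      E.b = p ∧ Regime.isolatedSing A E ∧ ∀ ξ ∈ E.sing,
        (maximalIdeal (A.Z.presheaf.stalk ξ)).spanFinrank = n + 1 ∧
        (∃ (E₀ : AdicCompletion (maximalIdeal (A.Z.presheaf.stalk ξ)) (A.Z.presheaf.stalk ξ) ≃+*
            MvPowerSeries (Option (Fin n)) K)
          (f₀ : A.Z.presheaf.stalk ξ) (c₀ : (Fin n → ℕ) → K) (w₀ : MvPowerSeries (Option (Fin n)) K),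
          stalkIdeal E.J ξ = Ideal.span {f₀} ∧ IsUnit w₀ ∧
            E₀ (algebraMap _ _ f₀) = w₀ * ((X none : MvPowerSeries (Option (Fin n)) K) ^ p -
              rename (some : Fin n → Option (Fin n)) (ser p n K c₀))) ∧
        (∀ (E₀ : AdicCompletion (maximalIdeal (A.Z.presheaf.stalk ξ)) (A.Z.presheaf.stalk ξ) ≃+*
            MvPowerSeries (Option (Fin n)) K)
          (f₀ : A.Z.presheaf.stalk ξ) (c₀ : (Fin n → ℕ) → K) (w₀ : MvPowerSeries (Option (Fin n)) K),
          stalkIdeal E.J ξ = Ideal.span {f₀} → IsUnit w₀ →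
            E₀ (algebraMap _ _ f₀) = w₀ * ((X none : MvPowerSeries (Option (Fin n)) K) ^ p -
              rename (some : Fin n → Option (Fin n)) (ser p n K c₀)) → Isol p n K c₀))
    (hrat : ∀ (A A' : AmbientDatum p K) (E : IdealExponent A.Z) (D : Closeds A.Z) (π : A'.Z ⟶ A.Z),
      Rg A E → Rg A' (E.transform π D) → A'.hom = π ≫ A.hom → IsBlowup π (vanishingIdeal D) →
        ∀ ξ' ∈ (E.transform π D).sing, π ξ' ∈ E.sing → ∀ y : A'.Z.presheaf.stalk ξ', ∃ r : A.Z.presheaf.stalk (π ξ'),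
          y - (π.stalkMap ξ').hom r ∈ maximalIdeal (A'.Z.presheaf.stalk ξ')) :
    FinLocalExitBound Rg := by
  classical
  refine finLocalExitBound_of_stepMeasureDrop (fun A E h => (hRg A E h).2.1.1)
    (fun A E x => 4 ^ sInf {m : ℕ | ∃ (E₀ : AdicCompletion (maximalIdeal (A.Z.presheaf.stalk x))
        (A.Z.presheaf.stalk x) ≃+* MvPowerSeries (Option (Fin n)) K)
        (f₀ : A.Z.presheaf.stalk x) (c₀ : (Fin n → ℕ) → K) (w₀ : MvPowerSeries (Option (Fin n)) K),
        stalkIdeal E.J x = Ideal.span {f₀} ∧ IsUnit w₀ ∧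
          E₀ (algebraMap _ _ f₀) = w₀ * ((X none : MvPowerSeries (Option (Fin n)) K) ^ p -
            rename (some : Fin n → Option (Fin n)) (ser p n K c₀)) ∧ m = mu p n K c₀})
    (stepMeasureDrop_of_offCentre_of_centre _ ?_ ?_)
  · -- off the centre the germ of the transform is the germ downstairs (brick 32 transport)
    intro A A' E E' D π _ _ _ _ _ _ hπ hEE' ξ' hoff _
    subst hEE'
    obtain ⟨e, he, -⟩ := transform_germ_eq_off_centre hπ E hoff
    dsimp only
    rw [← he, sInf_mu_eq_of_ringEquiv e (stalkIdeal E.J (π ξ'))]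
  · -- over the centre: the centre is a closed singular point `ξ`, and the fibre sum of `4^μ` drops (brick 32)
    intro A A' E E' D π hRgE hRgE' _ _ hD hhom hπ hEE' η hη t ht
    subst hEE'
    haveI : IsLocallyNoetherian A'.Z := ambient_isLocallyNoetherian A'
    obtain ⟨hb, hisoE, hgerm⟩ := hRg A E hRgE
    obtain ⟨-, -, hgerm'⟩ := hRg A' _ hRgE'
    obtain ⟨ξ, hξS, -, hDξ⟩ := IsPermissibleCentre.exists_eq_singleton_of_isolatedSing hD hisoE
    have hηξ : η = ξ := by
      have h : η ∈ ({ξ} : Set A.Z) := hDξ ▸ hη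
      exact h
    subst hηξ
    obtain ⟨hd, hex, hall⟩ := hgerm η hξS
    have hiso' : ∀ ξ' ∈ (E.transform π D).sing,
        (∀ y : A'.Z.presheaf.stalk ξ', ∃ r : A.Z.presheaf.stalk (π ξ'),
          y - (π.stalkMap ξ').hom r ∈ maximalIdeal (A'.Z.presheaf.stalk ξ')) ∧
        ∀ (E₀' : AdicCompletion (maximalIdeal (A'.Z.presheaf.stalk ξ')) (A'.Z.presheaf.stalk ξ') ≃+*
            MvPowerSeries (Option (Fin n)) K)
          (f₀' : A'.Z.presheaf.stalk ξ') (c' : (Fin n → ℕ) → K) (w' : MvPowerSeries (Option (Fin n)) K),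
          stalkIdeal (E.transform π D).J ξ' = Ideal.span {f₀'} → IsUnit w' →
            E₀' (algebraMap _ _ f₀') = w' * ((X none : MvPowerSeries (Option (Fin n)) K) ^ p -
              rename (some : Fin n → Option (Fin n)) (ser p n K c')) → Isol p n K c' :=
      fun ξ' hξ' => ⟨hrat A A' E D π hRgE hRgE' hhom hπ ξ' hξ'
        (sing_subset_of_transform hπ E hD.subset_sing hξ'), (hgerm' ξ' hξ').2.2⟩
    exact sum_pow_mu_lt_of_calculus_rat hn hord hcnt hmu π D hπ hb hDξ hξS hd hex hall hiso' t ht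

/-! ## Relative rationality: automatic over FINITE fields, and from `K`-rational singular points -/

omit [PerfectField K] in
/-- Over a FINITE field, in-regime steps of a regime contained in the finite-`Sing` forced-atom class have relatively
rational singular points: both `𝒪_{Z,π ξ′}` and `𝒪_{Z′,ξ′}` are presented, so both residue fields are `K` (bricks
16/17). [folklore] -/
theorem relRational_of_finite [Finite K] {A A' : AmbientDatum p K} {E : IdealExponent A.Z} {D : Closeds A.Z}
    {π : A'.Z ⟶ A.Z} {ξ' : A'.Z}
    (hex : ∃ (E₀ : AdicCompletion (maximalIdeal (A.Z.presheaf.stalk (π ξ'))) (A.Z.presheaf.stalk (π ξ')) ≃+*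
        MvPowerSeries (Option (Fin n)) K)
      (f₀ : A.Z.presheaf.stalk (π ξ')) (c₀ : (Fin n → ℕ) → K) (w₀ : MvPowerSeries (Option (Fin n)) K),
      stalkIdeal E.J (π ξ') = Ideal.span {f₀} ∧ IsUnit w₀ ∧
        E₀ (algebraMap _ _ f₀) = w₀ * ((X none : MvPowerSeries (Option (Fin n)) K) ^ p -
          rename (some : Fin n → Option (Fin n)) (ser p n K c₀)))
    (hex' : ∃ (E₀ : AdicCompletion (maximalIdeal (A'.Z.presheaf.stalk ξ')) (A'.Z.presheaf.stalk ξ') ≃+*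
        MvPowerSeries (Option (Fin n)) K)
      (f₀ : A'.Z.presheaf.stalk ξ') (c₀ : (Fin n → ℕ) → K) (w₀ : MvPowerSeries (Option (Fin n)) K),
      stalkIdeal (E.transform π D).J ξ' = Ideal.span {f₀} ∧ IsUnit w₀ ∧
        E₀ (algebraMap _ _ f₀) = w₀ * ((X none : MvPowerSeries (Option (Fin n)) K) ^ p -
          rename (some : Fin n → Option (Fin n)) (ser p n K c₀)))
    (y : A'.Z.presheaf.stalk ξ') :
    ∃ r : A.Z.presheaf.stalk (π ξ'), y - (π.stalkMap ξ').hom r ∈ maximalIdeal (A'.Z.presheaf.stalk ξ') := by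
  haveI : IsRegularLocalRing (A.Z.presheaf.stalk (π ξ')) := ambient_isRegular A _
  haveI : IsRegularLocalRing (A'.Z.presheaf.stalk ξ') := ambient_isRegular A' _
  obtain ⟨E₀, -⟩ := hex
  obtain ⟨E₀', -⟩ := hex'
  obtain ⟨eR⟩ := nonempty_residueField_equiv_of_presentation E₀
  obtain ⟨eS⟩ := nonempty_residueField_equiv_of_presentation E₀'
  exact exists_sub_map_mem_maximalIdeal_of_finite (π.stalkMap ξ').hom eR eS y

/-! ## The rungs over FINITE fields: surfaces in 3-space (`n = 2`) and curves (`n = 1`), every `p` -/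

/-- [OURS · L1 W4.6 rung (i) SURFACES IN 3-SPACE, GEOMETRIC FORM, over every FINITE field; NOT a statement of the
manuscript] For every prime `p` and every FINITE field `K` of characteristic `p`, every regime contained in «forced
atoms with finitely many singular points in `3` variables» has `FinLocalExitBound` (β = `4^μ`). [folklore] -/
theorem finLocalExitBound_of_le_forcedAtomsSurface_of_finite (hK : Finite K) (Rg : Regime p K)
    (hRg : ∀ (A : AmbientDatum p K) (E : IdealExponent A.Z), Rg A E →
      E.b = p ∧ Regime.isolatedSing A E ∧ ∀ ξ ∈ E.sing,
        (maximalIdeal (A.Z.presheaf.stalk ξ)).spanFinrank = 2 + 1 ∧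
        (∃ (E₀ : AdicCompletion (maximalIdeal (A.Z.presheaf.stalk ξ)) (A.Z.presheaf.stalk ξ) ≃+*
            MvPowerSeries (Option (Fin 2)) K)
          (f₀ : A.Z.presheaf.stalk ξ) (c₀ : (Fin 2 → ℕ) → K) (w₀ : MvPowerSeries (Option (Fin 2)) K),
          stalkIdeal E.J ξ = Ideal.span {f₀} ∧ IsUnit w₀ ∧
            E₀ (algebraMap _ _ f₀) = w₀ * ((X none : MvPowerSeries (Option (Fin 2)) K) ^ p -
              rename (some : Fin 2 → Option (Fin 2)) (ser p 2 K c₀))) ∧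
        (∀ (E₀ : AdicCompletion (maximalIdeal (A.Z.presheaf.stalk ξ)) (A.Z.presheaf.stalk ξ) ≃+*
            MvPowerSeries (Option (Fin 2)) K)
          (f₀ : A.Z.presheaf.stalk ξ) (c₀ : (Fin 2 → ℕ) → K) (w₀ : MvPowerSeries (Option (Fin 2)) K),
          stalkIdeal E.J ξ = Ideal.span {f₀} → IsUnit w₀ →
            E₀ (algebraMap _ _ f₀) = w₀ * ((X none : MvPowerSeries (Option (Fin 2)) K) ^ p -
              rename (some : Fin 2 → Option (Fin 2)) (ser p 2 K c₀)) → Isol p 2 K c₀)) :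
    FinLocalExitBound Rg :=
  have hp : p.Prime := Fact.out
  haveI := hK
  finLocalExitBound_of_calculus_rat (n := 2) two_pos
    (fun a i τ hM hI' hM' => SurfaceBranching.ser_mem_maximalIdeal_pow_succ_of_forcedSuccessor hp a i τ hM hI' hM')
    (fun a hM T hT => SurfaceBranching.card_le_three_of_forced_successors hp a hM T hT)
    (campaignW46HypersurfacesMuDrop_surface hp K) Rg hRg
    (fun A A' E _ _ hE hE' _ _ ξ' hξ' hπξ' y =>
      relRational_of_finite ((hRg A E hE).2.2 _ hπξ').2.1 ((hRg A' _ hE').2.2 ξ' hξ').2.1 y)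

/-- [OURS · L1 W4.6 rung (i) CURVES IN THE PLANE, GEOMETRIC FORM, over every FINITE field; NOT a statement of the
manuscript] The same for `n = 1`. [folklore] -/
theorem finLocalExitBound_of_le_forcedAtomsCurve_of_finite (hK : Finite K) (Rg : Regime p K)
    (hRg : ∀ (A : AmbientDatum p K) (E : IdealExponent A.Z), Rg A E →
      E.b = p ∧ Regime.isolatedSing A E ∧ ∀ ξ ∈ E.sing,
        (maximalIdeal (A.Z.presheaf.stalk ξ)).spanFinrank = 1 + 1 ∧
        (∃ (E₀ : AdicCompletion (maximalIdeal (A.Z.presheaf.stalk ξ)) (A.Z.presheaf.stalk ξ) ≃+*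
            MvPowerSeries (Option (Fin 1)) K)
          (f₀ : A.Z.presheaf.stalk ξ) (c₀ : (Fin 1 → ℕ) → K) (w₀ : MvPowerSeries (Option (Fin 1)) K),
          stalkIdeal E.J ξ = Ideal.span {f₀} ∧ IsUnit w₀ ∧
            E₀ (algebraMap _ _ f₀) = w₀ * ((X none : MvPowerSeries (Option (Fin 1)) K) ^ p -
              rename (some : Fin 1 → Option (Fin 1)) (ser p 1 K c₀))) ∧
        (∀ (E₀ : AdicCompletion (maximalIdeal (A.Z.presheaf.stalk ξ)) (A.Z.presheaf.stalk ξ) ≃+*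
            MvPowerSeries (Option (Fin 1)) K)
          (f₀ : A.Z.presheaf.stalk ξ) (c₀ : (Fin 1 → ℕ) → K) (w₀ : MvPowerSeries (Option (Fin 1)) K),
          stalkIdeal E.J ξ = Ideal.span {f₀} → IsUnit w₀ →
            E₀ (algebraMap _ _ f₀) = w₀ * ((X none : MvPowerSeries (Option (Fin 1)) K) ^ p -
              rename (some : Fin 1 → Option (Fin 1)) (ser p 1 K c₀)) → Isol p 1 K c₀)) :
    FinLocalExitBound Rg :=
  have hp : p.Prime := Fact.out
  haveI := hK
  finLocalExitBound_of_calculus_rat (n := 1) one_pos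
    (fun a _ _ hM _ _ => ser_mem_maximalIdeal_pow_succ_of_multP_one a hM)
    (fun a _ T hT => card_le_three_of_canonical_one a T hT)
    (campaignW46HypersurfacesMuDrop_curve hp K) Rg hRg
    (fun A A' E _ _ hE hE' _ _ ξ' hξ' hπξ' y =>
      relRational_of_finite ((hRg A E hE).2.2 _ hπξ').2.1 ((hRg A' _ hE').2.2 ξ' hξ').2.1 y)

/-! ## The rungs over PERFECT fields at `K`-rational singular points -/

/-- [OURS · L1 W4.6 rung (i) SURFACES IN 3-SPACE, GEOMETRIC FORM, over every PERFECT field with `K`-RATIONAL singular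
points; NOT a statement of the manuscript] For every prime `p` and every perfect field `K` of characteristic `p`: every
regime contained in «forced atoms with finitely many singular points in `3` variables, all `K`-rational» has
`FinLocalExitBound` (β = `4^μ`). [folklore] -/
theorem finLocalExitBound_of_le_forcedAtomsSurfaceRational (Rg : Regime p K)
    (hRg : ∀ (A : AmbientDatum p K) (E : IdealExponent A.Z), Rg A E →
      (E.b = p ∧ Regime.isolatedSing A E ∧ ∀ ξ ∈ E.sing,
        (maximalIdeal (A.Z.presheaf.stalk ξ)).spanFinrank = 2 + 1 ∧
        (∃ (E₀ : AdicCompletion (maximalIdeal (A.Z.presheaf.stalk ξ)) (A.Z.presheaf.stalk ξ) ≃+*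
            MvPowerSeries (Option (Fin 2)) K)
          (f₀ : A.Z.presheaf.stalk ξ) (c₀ : (Fin 2 → ℕ) → K) (w₀ : MvPowerSeries (Option (Fin 2)) K),
          stalkIdeal E.J ξ = Ideal.span {f₀} ∧ IsUnit w₀ ∧
            E₀ (algebraMap _ _ f₀) = w₀ * ((X none : MvPowerSeries (Option (Fin 2)) K) ^ p -
              rename (some : Fin 2 → Option (Fin 2)) (ser p 2 K c₀))) ∧
        (∀ (E₀ : AdicCompletion (maximalIdeal (A.Z.presheaf.stalk ξ)) (A.Z.presheaf.stalk ξ) ≃+*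
            MvPowerSeries (Option (Fin 2)) K)
          (f₀ : A.Z.presheaf.stalk ξ) (c₀ : (Fin 2 → ℕ) → K) (w₀ : MvPowerSeries (Option (Fin 2)) K),
          stalkIdeal E.J ξ = Ideal.span {f₀} → IsUnit w₀ →
            E₀ (algebraMap _ _ f₀) = w₀ * ((X none : MvPowerSeries (Option (Fin 2)) K) ^ p -
              rename (some : Fin 2 → Option (Fin 2)) (ser p 2 K c₀)) → Isol p 2 K c₀)) ∧
      ∀ ξ ∈ E.sing, ∀ y : A.Z.presheaf.stalk ξ, ∃ l : K,
        y - (A.Z.presheaf.germ ⊤ ξ trivial).hom (sectionConst A.hom ⊤ l) ∈ maximalIdeal (A.Z.presheaf.stalk ξ)) :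
    FinLocalExitBound Rg :=
  have hp : p.Prime := Fact.out
  finLocalExitBound_of_calculus_rat (n := 2) two_pos
    (fun a i τ hM hI' hM' => SurfaceBranching.ser_mem_maximalIdeal_pow_succ_of_forcedSuccessor hp a i τ hM hI' hM')
    (fun a hM T hT => SurfaceBranching.card_le_three_of_forced_successors hp a hM T hT)
    (campaignW46HypersurfacesMuDrop_surface hp K) Rg (fun A E h => (hRg A E h).1)
    (fun A A' _ _ π _ hE' hhom _ ξ' hξ' _ y =>
      exists_sub_stalkMap_mem_maximalIdeal_of_kRational π A.hom A'.hom hhom ξ' ((hRg A' _ hE').2 ξ' hξ') y)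

/-- [OURS · L1 W4.6 rung (i) CURVES IN THE PLANE, GEOMETRIC FORM, over every PERFECT field with `K`-RATIONAL singular
points; NOT a statement of the manuscript] The same for `n = 1`. [folklore] -/
theorem finLocalExitBound_of_le_forcedAtomsCurveRational (Rg : Regime p K)
    (hRg : ∀ (A : AmbientDatum p K) (E : IdealExponent A.Z), Rg A E →
      (E.b = p ∧ Regime.isolatedSing A E ∧ ∀ ξ ∈ E.sing,
        (maximalIdeal (A.Z.presheaf.stalk ξ)).spanFinrank = 1 + 1 ∧
        (∃ (E₀ : AdicCompletion (maximalIdeal (A.Z.presheaf.stalk ξ)) (A.Z.presheaf.stalk ξ) ≃+*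
            MvPowerSeries (Option (Fin 1)) K)
          (f₀ : A.Z.presheaf.stalk ξ) (c₀ : (Fin 1 → ℕ) → K) (w₀ : MvPowerSeries (Option (Fin 1)) K),
          stalkIdeal E.J ξ = Ideal.span {f₀} ∧ IsUnit w₀ ∧
            E₀ (algebraMap _ _ f₀) = w₀ * ((X none : MvPowerSeries (Option (Fin 1)) K) ^ p -
              rename (some : Fin 1 → Option (Fin 1)) (ser p 1 K c₀))) ∧
        (∀ (E₀ : AdicCompletion (maximalIdeal (A.Z.presheaf.stalk ξ)) (A.Z.presheaf.stalk ξ) ≃+*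
            MvPowerSeries (Option (Fin 1)) K)
          (f₀ : A.Z.presheaf.stalk ξ) (c₀ : (Fin 1 → ℕ) → K) (w₀ : MvPowerSeries (Option (Fin 1)) K),
          stalkIdeal E.J ξ = Ideal.span {f₀} → IsUnit w₀ →
            E₀ (algebraMap _ _ f₀) = w₀ * ((X none : MvPowerSeries (Option (Fin 1)) K) ^ p -
              rename (some : Fin 1 → Option (Fin 1)) (ser p 1 K c₀)) → Isol p 1 K c₀)) ∧
      ∀ ξ ∈ E.sing, ∀ y : A.Z.presheaf.stalk ξ, ∃ l : K,
        y - (A.Z.presheaf.germ ⊤ ξ trivial).hom (sectionConst A.hom ⊤ l) ∈ maximalIdeal (A.Z.presheaf.stalk ξ)) :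
    FinLocalExitBound Rg :=
  have hp : p.Prime := Fact.out
  finLocalExitBound_of_calculus_rat (n := 1) one_pos
    (fun a _ _ hM _ _ => ser_mem_maximalIdeal_pow_succ_of_multP_one a hM)
    (fun a _ T hT => card_le_three_of_canonical_one a T hT)
    (campaignW46HypersurfacesMuDrop_curve hp K) Rg (fun A E h => (hRg A E h).1)
    (fun A A' _ _ π _ hE' hhom _ ξ' hξ' _ y =>
      exists_sub_stalkMap_mem_maximalIdeal_of_kRational π A.hom A'.hom hhom ξ' ((hRg A' _ hE').2 ξ' hξ') y)

/-! ## Résumé-free termination -/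

/-- [OURS · L1 W4.6 rung (i) SURFACES IN 3-SPACE over every FINITE field, résumé-free; NOT a statement of the manuscript]
No infinite §2.1-permissible sequence stays inside a regime of forced atoms with finitely many singular points in `3`
variables over a finite field. [folklore] -/
theorem permissiblyTerminates_of_le_forcedAtomsSurface_of_finite (hK : Finite K) (Rg : Regime p K)
    (hRg : ∀ (A : AmbientDatum p K) (E : IdealExponent A.Z), Rg A E →
      E.b = p ∧ Regime.isolatedSing A E ∧ ∀ ξ ∈ E.sing,
        (maximalIdeal (A.Z.presheaf.stalk ξ)).spanFinrank = 2 + 1 ∧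
        (∃ (E₀ : AdicCompletion (maximalIdeal (A.Z.presheaf.stalk ξ)) (A.Z.presheaf.stalk ξ) ≃+*
            MvPowerSeries (Option (Fin 2)) K)
          (f₀ : A.Z.presheaf.stalk ξ) (c₀ : (Fin 2 → ℕ) → K) (w₀ : MvPowerSeries (Option (Fin 2)) K),
          stalkIdeal E.J ξ = Ideal.span {f₀} ∧ IsUnit w₀ ∧
            E₀ (algebraMap _ _ f₀) = w₀ * ((X none : MvPowerSeries (Option (Fin 2)) K) ^ p -
              rename (some : Fin 2 → Option (Fin 2)) (ser p 2 K c₀))) ∧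
        (∀ (E₀ : AdicCompletion (maximalIdeal (A.Z.presheaf.stalk ξ)) (A.Z.presheaf.stalk ξ) ≃+*
            MvPowerSeries (Option (Fin 2)) K)
          (f₀ : A.Z.presheaf.stalk ξ) (c₀ : (Fin 2 → ℕ) → K) (w₀ : MvPowerSeries (Option (Fin 2)) K),
          stalkIdeal E.J ξ = Ideal.span {f₀} → IsUnit w₀ →
            E₀ (algebraMap _ _ f₀) = w₀ * ((X none : MvPowerSeries (Option (Fin 2)) K) ^ p -
              rename (some : Fin 2 → Option (Fin 2)) (ser p 2 K c₀)) → Isol p 2 K c₀)) :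
    PermissiblyTerminates Rg :=
  permissiblyTerminates_of_finLocalExitBound (fun A E h => (hRg A E h).2.1.1)
    (finLocalExitBound_of_le_forcedAtomsSurface_of_finite hK Rg hRg)

end CampaignW46.ForcedAtom

end Summit.ResolutionOfSingularities.ResolutionOfSingularities.Theorems

end
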